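import Literature.MathematicalPhysics.QuantumFieldTheory.Balaban1983to89.B11Eq80Current
import Literature.MathematicalPhysics.QuantumFieldTheory.Balaban1983to89.B11Eq26ExpansionZpow

/-!
# `Balaban1983to89.B11Eq80CurrentZpow` — T. Bałaban, *The variational problem and background fields in renormalization group method for lattice gauge theories*, Commun. Math. Phys. **102** (1985) 277–309 [Balaban1985Variational]: (63) p. 287, (80) p. 290, (84)–(90) pp. 290–291 — THE (63) CERTIFICATE `⟨W(A′), δ⟩ = (d/dt)V(A′ + tδ)|_{t=0}` FOR THE W-SLOT OBJECT `B11Eq80Current.W80` IN EVERY DIMENSION `d` (in particular `d = 3`), against (80) written with the integer-power remainder `V₀` of `B11Eq26ExpansionZpow`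

statement-level skeleton of published theorems with citation tags; proofs where landed; nothing here is a claim about the Yang–Mills mass gap

PDF held: `paper:balaban1985-cmp102-variational-background` (journal page = PDF page + 276); displays (5) p. 278, (26)/(30) p. 282, (63) p. 287,
(80) p. 290, (84)–(90) pp. 290–291 as transcribed in `B11Eq26ActionExpansion`, `B11Eq26ExpansionZpow`, `B11Eq80Current` (not repeated).

CITATION HEADER (lean-in-tree rule 2026-08-18).  WHAT IS REPRODUCED: the `d`-generic reading of the (63)-certificates of the lineage
`B11Eq63V0GroupCurrent.bondPair_curV0` → `B11Eq90V0GroupComposed.pair27_curV0full` → `B11Eq80Current.pair27_W80`.  THE LOCATED SCOPE NOTE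
(cell `ym3-torus`, EX namer ★w2-19200 g6, 2026-08-28 19:24Z): those three certificates carry the binder `hd : 4 ≤ d` — EMPTY at `d = 3`, the
dimension of [Balaban1985UV3] and of rung R3 (YM₃ on T³) — although the OBJECTS they certify (`curV0 := curV0prime + curComm`,
`curV0full := pullCur ρ τ T47 curV0`, `W80 := W1 + W2 + W3 + curV0full`) and their analyticity / (98)-slots (`differentiableOn_W80`,
`analyticOnNhd_W80`, `quadAnalytic_curV0`, `prop4Hyp_curV0full`) are typed for every `d`.  The guard enters at ONE place: the reference
functional of the certificates is r08's `B11Eq26ActionExpansion.V0` — the remainder of (26) on the carrier `B9Eq39Adjoint.action`, whose printed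
weight `η^{d−4}` of (5) is typed with the natural-number subtraction `d - 4` — and (30) `eq30a : V₀ = Σ_p η^d V₀(A, ∂p)` for it needs `4 ≤ d`.
The cure is lit-balaban's scope note L6-1 and its twin `B11Eq26ExpansionZpow` (INTERFACES-r06 §36b: «replace `action`/`eq312` by
`actionZ`/`eq312_zpow` and drop the `4 ≤ d` binder»): `V0Z` (the SAME (26) on the integer-power action `B9Eq31ActionZpow.actionZ`), `eq30a_zpow`
(`V0Z = Σ_p η^d V0p` for EVERY `d`, the same per-plaquette `V0p`), `V0Z_eq_V0 (hd : 4 ≤ d)`, `differentiable_V0Z`.  THIS FILE is the downstream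
half of that recipe for the (63)/(80) lineage, as a TWIN (nothing of `B11Eq63V0GroupCurrent` / `B11Eq90V0GroupComposed` / `B11Eq80Current` is
modified — def-body guard; the EX knit of rung R3 reads `W80` at `d = 3`):
* §1 **`bondPair_curV0_zpow`** — (63) for the V₀-group current `curV0` against `V0Z`, every `d` (proof of `bondPair_curV0` verbatim with
  `eq30a_zpow` for `eq30a hd`);
* §2 **`differentiable_V0Z_torus`** (bookkeeping: `B11Eq26ExpansionZpow.differentiable_V0Z` read at the torus letters `Tsh`, `Ucur U₀`),
  **`pair27_curV0full_zpow`** — (63) for the composed V₀-group `curV0full` against `V0Z ∘ T47`, every `d`;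
* §3 **`V80Z`** — (80) VERBATIM as `B11Eq80Current.V80` but with `V0Z` as its fourth term (so it IS print's `V(A′)` in every `d`; `V80Z_eq_V80` for
  `4 ≤ d`), and ★ **`pair27_W80_zpow`** — `⟨W80(A′), δ⟩ = (d/dt) V80Z(A′ + tδ)|_{t=0}` on `‖A′‖ < a_C` for EVERY `d`: `W80` IS `(δ/δA′)V` in the sense
  of (63)/(84) without the dimension guard; uniqueness as before (`B11Eq90Transpose.eq_of_pair27_eq`).
* §4 sanity at `d = 3`: the fourth term of `V80Z` is `Σ_p η³ V₀(A, ∂p)` (`V80Z_three`, from `B11Eq26ExpansionZpow.V0Z_three`).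
* §5 (v1.1, append-only) **`differentiableOn_V80Z`**, ★ **`hasDerivAt_V80Z_line`**, **`hasDerivAt_V80Z_line_real`** — the same certificate in
  `HasDerivAt` currency along a complex / real ray parameter (the form a consumer's own `HasDerivAt` of a ray functional composes with).

DICTIONARY.  Exactly as in `B11Eq80Current` (nothing re-declared): `Space115`, `NegSize`, `flat115`, `curL`, `pair27`, `Tsh`, `Ucur`, `T47`, `Emap`,
`E3`, `W1 W2 W3 W80`, `curV0`, `curV0full`, `Regime`, `Prop4Hyp`; `V0Z` of `B11Eq26ExpansionZpow`.

HONEST SCOPE — what is NOT claimed.  (i) Only the reference functional of the certificates changes (`V0 ↦ V0Z`); every honest-scope item of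
`B11Eq80Current` stands ((98) for `W80` NOT proved here; `J`, `Δπ`, `ρ`, `τ` letters; DIVERGENCE D-pv27.4).  (ii) For `4 ≤ d` the statements are
the tree's (`V80Z_eq_V80`); the new content is `d ≤ 3`.  (iii) No row head of r08's `ROWS-B11.md` changes.  (iv) Not summit progress: YM₃ on T³ is a
ladder rung (R3), not d = 4, not Clay; nothing here claims a stub, a crux or the mass gap.  Cell `ym3-torus`, width seat `ym3-torus-px19` (gen 2),
`--supports stmt-QuantumFields-19200`; count-neutral.

Depends on (BY NAME): `B11Eq80Current` (`V80`, `W80`, `W1`, `W2`, `W3`, `Emap`, `E3`, `pairL`, `pairL_apply`, `hasDerivAt_line`,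
`hasDerivAt_comp_line`, `analyticOnNhd_Emap`, `analyticOnNhd_E3`), `B11Eq90V0GroupComposed` (`T47`, `curV0full`, `differentiableOn_T47`),
`B11Eq63V0GroupCurrent` (`curV0`, `bondPair_curComm`), `B11Eq98V0primeCurrentSlots` (`bondPair_curV0prime`), `B11Eq90V0primeBond` (`V0primeP`,
`term39`, `contDiff_V0primeP`, `contDiff_term39`), `B11Eq90Pullback` (`pair27_pullCur`), `B11Eq90Transpose` (`pair27`, `pair27_def`,
`pair27_add_left`, `pair27_neg_left`, `pair27_transCur'`), `B11Eq26ExpansionZpow` (`V0Z`, `eq30a_zpow`, `differentiable_V0Z`, `V0Z_eq_V0`,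
`V0Z_three`).
-/

noncomputable section

open NormedSpace Complex Metric Set Finset Filter Topology

namespace Literature.MathematicalPhysics.QuantumFieldTheory.Balaban1983to89.B11Eq80CurrentZpow

open Literature.MathematicalPhysics.QuantumFieldTheory.Balaban1983to89.B9Eq39Adjoint (bondPair posPlaq)
open Literature.MathematicalPhysics.QuantumFieldTheory.Balaban1983to89.B11Prop6Scheme (Prop4Hyp)
open Literature.MathematicalPhysics.QuantumFieldTheory.Balaban1983to89.B11Eq174Chart (solA Regime)
open Literature.MathematicalPhysics.QuantumFieldTheory.Balaban1983to89.B11Eq26ActionExpansion (V0 V0p)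
open Literature.MathematicalPhysics.QuantumFieldTheory.Balaban1983to89.B11Eq26ExpansionZpow (V0Z eq30a_zpow differentiable_V0Z
  V0Z_eq_V0 V0Z_three)
open Literature.MathematicalPhysics.QuantumFieldTheory.Balaban1983to89.B11Eq90V0primeBond (V0primeP term39 contDiff_V0primeP
  contDiff_term39)
open Literature.MathematicalPhysics.QuantumFieldTheory.Balaban1983to89.B11Eq90V0primeCurrent (Tsh Ucur curL curL_apply flat115
  flat115_apply)
open Literature.MathematicalPhysics.QuantumFieldTheory.Balaban1983to89.B11Eq98V0primeCurrentSlots (bondPair_curV0prime)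
open Literature.MathematicalPhysics.QuantumFieldTheory.Balaban1983to89.B11Eq63V0GroupCurrent (curV0 bondPair_curComm)
open Literature.MathematicalPhysics.QuantumFieldTheory.Balaban1983to89.B11Eq90Transpose
open Literature.MathematicalPhysics.QuantumFieldTheory.Balaban1983to89.B11Eq90Pullback
open Literature.MathematicalPhysics.QuantumFieldTheory.Balaban1983to89.B11Eq90V0GroupComposed
open Literature.MathematicalPhysics.QuantumFieldTheory.Balaban1983to89.B11Eq80Current
open B9SectCLatticeCarrier (Bond)
open B4Sect5Torus (TSite)
open B11Eq115Space

variable {𝔸 : Type*} [NormedRing 𝔸] [NormedAlgebra ℂ 𝔸]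
variable {d : ℕ} {Pd : Fin d → ℕ} {L η : ℝ} [Fact (0 < L)] [Fact (0 < η)] {lev₀ : Bond d Pd → ℕ} {κ' : Type*} [Fintype κ']
  {lev₁ : κ' → ℕ} {Dc : (Bond d Pd → 𝔸) →ₗ[ℂ] (κ' → 𝔸)}
variable {𝒳 : Type*} [NormedAddCommGroup 𝒳] [NormedSpace ℂ 𝒳]

/-! ## §1 (63) for the V₀-group current `curV0` against the integer-power `V₀`, every `d` -/

section CurV0

variable [CompleteSpace 𝔸]

/-- **(63) FOR THE WHOLE `V₀`, EVERY `d`**: `⟨curV0(Y), δ⟩ = (d/dt) V₀(Y + tδ)|_{t=0}` with `V₀ = B11Eq26ExpansionZpow.V0Z` — the remainder of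
(26) on the printed action (5) with its weight `η^{d−4}` as an INTEGER power (tracial `τ`, `η ≠ 0`; NO `4 ≤ d`), given the dualising identity
`τ(ρ(ℓ)X) = ℓ X`.  The twin of `B11Eq63V0GroupCurrent.bondPair_curV0` (which states it for r08's ℕ-power `V0` under `4 ≤ d`); same proof with
(30) in the form `B11Eq26ExpansionZpow.eq30a_zpow`. [cite: Balaban1985Variational, (63) p.287, (26) p.282, (30) p.282] -/
theorem bondPair_curV0_zpow (ρ : (𝔸 →L[ℂ] ℂ) →L[ℂ] 𝔸) (τ : 𝔸 →L[ℂ] ℂ)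
    (hρ : ∀ (ℓ : 𝔸 →L[ℂ] ℂ) (X : 𝔸), τ (ρ ℓ * X) = ℓ X) (hτ : ∀ a b : 𝔸, τ (a * b) = τ (b * a))
    (U₀ : Bond d Pd → 𝔸ˣ) (Y : Space115 L η lev₀ lev₁ Dc) (δ : Bond d Pd → 𝔸) :
    bondPair η d (τ : 𝔸 →ₗ[ℂ] ℂ) (curL (NegSup.equiv (levWeight L η lev₀ 3) 𝔸 (curV0 (lev₁ := lev₁) (Dc := Dc) ρ τ U₀ Y))) (curL δ)
      = deriv (fun t : ℂ => V0Z Tsh (Ucur U₀) η d (τ : 𝔸 →ₗ[ℂ] ℂ)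
          (curL (JetSup.equiv (levWeight L η lev₀ 1) (levWeight L η lev₁ 2) Dc Y) + t • curL δ)) 0 := by
  have hη : (η : ℝ) ≠ 0 := (Fact.out : 0 < η).ne'
  set A := curL (JetSup.equiv (levWeight L η lev₀ 1) (levWeight L η lev₁ 2) Dc Y) with hA
  set D := curL (𝔸 := 𝔸) δ with hD
  -- (30) in the integer-power form, with (39): V₀ = Σ η^d V′₀ + Σ η^d term39
  have e30 : (fun t : ℂ => V0Z Tsh (Ucur U₀) η d (τ : 𝔸 →ₗ[ℂ] ℂ) (A + t • D))
      = fun t => (∑ q ∈ posPlaq (TSite d Pd) (Fin d), (η : ℂ) ^ d * V0primeP Tsh (Ucur U₀) η (τ : 𝔸 →ₗ[ℂ] ℂ) (A + t • D) q.2.1 q.2.2 q.1)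
          + ∑ q ∈ posPlaq (TSite d Pd) (Fin d), (η : ℂ) ^ d * term39 Tsh (Ucur U₀) η (τ : 𝔸 →ₗ[ℂ] ℂ) (A + t • D) q.2.1 q.2.2 q.1 := by
    funext t
    rw [eq30a_zpow Tsh (Ucur U₀) (τ : 𝔸 →ₗ[ℂ] ℂ) hτ η hη d, ← Finset.sum_add_distrib]
    refine Finset.sum_congr rfl fun q _ => ?_
    rw [V0primeP]; ring
  have h1 : Differentiable ℂ (fun t : ℂ => ∑ q ∈ posPlaq (TSite d Pd) (Fin d),
      (η : ℂ) ^ d * V0primeP Tsh (Ucur U₀) η (τ : 𝔸 →ₗ[ℂ] ℂ) (A + t • D) q.2.1 q.2.2 q.1) := by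
    refine Differentiable.fun_sum fun q _ => (Differentiable.const_mul ?_ _)
    exact ((contDiff_V0primeP Tsh (Ucur U₀) (n := 1) η τ q.2.1 q.2.2 q.1).differentiable (by norm_num)).comp (by fun_prop)
  have h2 : Differentiable ℂ (fun t : ℂ => ∑ q ∈ posPlaq (TSite d Pd) (Fin d),
      (η : ℂ) ^ d * term39 Tsh (Ucur U₀) η (τ : 𝔸 →ₗ[ℂ] ℂ) (A + t • D) q.2.1 q.2.2 q.1) := by
    refine Differentiable.fun_sum fun q _ => (Differentiable.const_mul ?_ _)
    exact ((contDiff_term39 Tsh (Ucur U₀) (n := 1) η τ q.2.1 q.2.2 q.1).differentiable (by norm_num)).comp (by fun_prop)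
  rw [e30, ((h1 0).hasDerivAt.fun_add (h2 0).hasDerivAt).deriv,
    ← bondPair_curV0prime (lev₁ := lev₁) (Dc := Dc) ρ τ hρ U₀ Y δ, ← bondPair_curComm (lev₁ := lev₁) (Dc := Dc) ρ τ hρ U₀ Y δ]
  simp only [curV0, bondPair, map_add, NegSup.equiv_add, curL_apply, Pi.add_apply, add_mul, Finset.sum_add_distrib, mul_add, hD]

end CurV0

/-! ## §2 (63) for the composed V₀-group `curV0full` against `V0Z ∘ T47`, every `d` -/

section V0Group

variable [FiniteDimensional ℂ 𝔸] [CompleteSpace 𝔸] {H : 𝒳 →L[ℂ] Space115 L η lev₀ lev₁ Dc} {C : Space115 L η lev₀ lev₁ Dc → 𝒳}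
  {b C₂ c₄ aC εC : ℝ}

omit [FiniteDimensional ℂ 𝔸] in
/-- `V₀` of (26) — integer-power weight — is an entire function of the configuration, read at the torus letters `Tsh`, `Ucur U₀` (p. 282:
«an analytic, and even an entire function of A»; `B11Eq26ExpansionZpow.differentiable_V0Z`, every `d`).  Twin of
`B11Eq90V0GroupComposed.differentiable_V0` without `4 ≤ d`. [cite: Balaban1985Variational, p.282, (30) p.282] -/
theorem differentiable_V0Z_torus (τ : 𝔸 →L[ℂ] ℂ) (hτ : ∀ a b : 𝔸, τ (a * b) = τ (b * a)) (U₀ : Bond d Pd → 𝔸ˣ) :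
    Differentiable ℂ (V0Z Tsh (Ucur U₀) η d (τ : 𝔸 →ₗ[ℂ] ℂ) : (Fin d → TSite d Pd → 𝔸) → ℂ) :=
  differentiable_V0Z Tsh (Ucur U₀) τ hτ η (Fact.out : 0 < η).ne' d

/-- **(63) FOR THE COMPOSED V₀-GROUP, EVERY `d` — THE PAIRING CERTIFICATE**: for `‖A′‖ < a_C` (Sect. C regime, `C` of Prop.-4 type on its ball),
a tracial `τ` and the dualising identity `τ(ρ(ℓ)X) = ℓ X`: `⟨curV0full(A′), δ⟩ = (d/dt) V₀(T(A′ + tδ))|_{t=0}` with `V₀ = B11Eq26ExpansionZpow.V0Z`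
(integer-power weight) and `T` = (47) — i.e. `curV0full` IS `(δ/δA′) V₀(A′ − HD(A′))`, the last term of (80) differentiated at `A′`, with NO
dimension guard.  Twin of `B11Eq90V0GroupComposed.pair27_curV0full` (`4 ≤ d`, ℕ-power `V0`); same proof over §1.
[cite: Balaban1985Variational, (63) p.287, (80) p.290, (90) p.291] -/
theorem pair27_curV0full_zpow (ρ : (𝔸 →L[ℂ] ℂ) →L[ℂ] 𝔸) (τ : 𝔸 →L[ℂ] ℂ)
    (hρ : ∀ (ℓ : 𝔸 →L[ℂ] ℂ) (X : 𝔸), τ (ρ ℓ * X) = ℓ X) (hτ : ∀ a b : 𝔸, τ (a * b) = τ (b * a))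
    (U₀ : Bond d Pd → 𝔸ˣ) (RC : Regime H 0 C b 0 C₂ c₄ 0 aC εC) (hC : Prop4Hyp C C₂ c₄) {A' : Space115 L η lev₀ lev₁ Dc}
    (hA' : ‖A'‖ < aC) (δ : Bond d Pd → 𝔸) :
    pair27 τ (curV0full ρ τ U₀ H C εC A') δ
      = deriv (fun t : ℂ => V0Z Tsh (Ucur U₀) η d (τ : 𝔸 →ₗ[ℂ] ℂ)
          (curL (flat115 (T47 H C εC (A' + t • (JetSup.equiv (levWeight L η lev₀ 1) (levWeight L η lev₁ 2) Dc).symm δ))))) 0 := by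
  have hT : DifferentiableAt ℂ (T47 H C εC) A' :=
    (differentiableOn_T47 RC hC).differentiableAt (isOpen_ball.mem_nhds (mem_ball_zero_iff.2 hA'))
  have hF : Differentiable ℂ (fun Y : Space115 L η lev₀ lev₁ Dc => V0Z Tsh (Ucur U₀) η d (τ : 𝔸 →ₗ[ℂ] ℂ) (curL (flat115 Y))) :=
    (differentiable_V0Z_torus τ hτ U₀).comp
      (((curL : (Bond d Pd → 𝔸) →L[ℂ] (Fin d → TSite d Pd → 𝔸)).comp
        (flat115 (L := L) (η := η) (lev₀ := lev₀) (lev₁ := lev₁) (Dc := Dc))).differentiable)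
  refine pair27_pullCur ρ τ hρ (F := fun Y => V0Z Tsh (Ucur U₀) η d (τ : 𝔸 →ₗ[ℂ] ℂ) (curL (flat115 Y))) (fun δ' => ?_) hT (hF _) δ
  -- the (63)-certificate of `curV0` against `V0Z` (§1); `flat115 (Y + tδ) = flat115 Y + t·δ`
  rw [pair27_def, bondPair_curV0_zpow (lev₁ := lev₁) (Dc := Dc) ρ τ hρ hτ U₀ _ δ']
  exact congrArg (fun f : ℂ → ℂ => deriv f 0)
    (funext fun t => by simp only [map_add, map_smul, flat115_apply, Equiv.apply_symm_apply])

end V0Group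

/-! ## §3 `V(A′)` of (80) with the integer-power `V₀`, and the (63) certificate for `W80` in every `d` -/

section Current

variable [FiniteDimensional ℂ 𝔸] [CompleteSpace 𝔸] {H : 𝒳 →L[ℂ] Space115 L η lev₀ lev₁ Dc} {C : Space115 L η lev₀ lev₁ Dc → 𝒳}
  {b C₂ c₄ aC εC : ℝ}

/-- **`V(A′)` OF (80), EVERY `d`**: `V(A′) = −⟨HD₃(A′), J⟩ − ⟨A′, Δ_π HD(A′)⟩ + ½⟨HD(A′), Δ_π HD(A′)⟩ + V₀(A′ − HD(A′))`, VERBATIM as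
`B11Eq80Current.V80` but with the fourth term `V₀ = B11Eq26ExpansionZpow.V0Z` (the remainder of (26) on the printed action (5) with the
weight `η^{d−4}` as an integer power) in place of r08's ℕ-power `B11Eq26ActionExpansion.V0`; `= V80` for `4 ≤ d` (`V80Z_eq_V80`); at `d = 3`
its fourth term is `Σ_p η³ V₀(A, ∂p)` as printed (`V80Z_three`).  Letters `J`, `Δπ`, `H`, `C`, `ε_C`, `τ`, `U₀` as there.
[cite: Balaban1985Variational, (80) p.290, (5) p.278, (26) p.282] -/
def V80Z (τ : 𝔸 →L[ℂ] ℂ) (U₀ : Bond d Pd → 𝔸ˣ) (H : 𝒳 →L[ℂ] Space115 L η lev₀ lev₁ Dc) (C : Space115 L η lev₀ lev₁ Dc → 𝒳) (εC : ℝ)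
    (J : NegSize L η lev₀ 3 𝔸) (Δπ : Space115 L η lev₀ lev₁ Dc →L[ℂ] NegSize L η lev₀ 3 𝔸) (A' : Space115 L η lev₀ lev₁ Dc) : ℂ :=
  -pair27 τ J (flat115 (E3 H C εC A')) - pair27 τ (Δπ (Emap H C εC A')) (flat115 A')
    + 2⁻¹ * pair27 τ (Δπ (Emap H C εC A')) (flat115 (Emap H C εC A'))
    + V0Z Tsh (Ucur U₀) η d (τ : 𝔸 →ₗ[ℂ] ℂ) (curL (flat115 (T47 H C εC A')))

omit [FiniteDimensional ℂ 𝔸] in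
/-- **BRIDGE**: for `4 ≤ d`, `V80Z = B11Eq80Current.V80` (the fourth terms agree by `B11Eq26ExpansionZpow.V0Z_eq_V0`).
[cite: Balaban1985Variational, (80) p.290] -/
theorem V80Z_eq_V80 (hd : 4 ≤ d) (τ : 𝔸 →L[ℂ] ℂ) (U₀ : Bond d Pd → 𝔸ˣ) (εC : ℝ) (J : NegSize L η lev₀ 3 𝔸)
    (Δπ : Space115 L η lev₀ lev₁ Dc →L[ℂ] NegSize L η lev₀ 3 𝔸) (A' : Space115 L η lev₀ lev₁ Dc) :
    V80Z τ U₀ H C εC J Δπ A' = V80 τ U₀ H C εC J Δπ A' := by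
  rw [V80Z, V80, V0Z_eq_V0 Tsh (Ucur U₀) η hd]

omit [FiniteDimensional ℂ 𝔸] in
/-- **SANITY AT `d = 3`** (the dimension of [Balaban1985UV3] / rung R3): the fourth term of `V80Z` is `Σ_p η³·V₀(A, ∂p)` — the printed
`η^{d−4}Σ_p ρ_p = η⁻¹Σ_p ρ_p` of (26)/(30), not the ℕ-power artefact `η⁰`. [cite: Balaban1985Variational, (26) p.282, (30) p.282, (80) p.290] -/
theorem V80Z_three {Pd : Fin 3 → ℕ} {lev₀ : Bond 3 Pd → ℕ} {Dc : (Bond 3 Pd → 𝔸) →ₗ[ℂ] (κ' → 𝔸)}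
    {H : 𝒳 →L[ℂ] Space115 L η lev₀ lev₁ Dc} {C : Space115 L η lev₀ lev₁ Dc → 𝒳}
    (τ : 𝔸 →L[ℂ] ℂ) (hτ : ∀ a b : 𝔸, τ (a * b) = τ (b * a)) (U₀ : Bond 3 Pd → 𝔸ˣ) (εC : ℝ) (J : NegSize L η lev₀ 3 𝔸)
    (Δπ : Space115 L η lev₀ lev₁ Dc →L[ℂ] NegSize L η lev₀ 3 𝔸) (A' : Space115 L η lev₀ lev₁ Dc) :
    V80Z τ U₀ H C εC J Δπ A'
      = -pair27 τ J (flat115 (E3 H C εC A')) - pair27 τ (Δπ (Emap H C εC A')) (flat115 A')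
        + 2⁻¹ * pair27 τ (Δπ (Emap H C εC A')) (flat115 (Emap H C εC A'))
        + ∑ q ∈ posPlaq (TSite 3 Pd) (Fin 3),
            (η : ℂ) ^ 3 * V0p Tsh (Ucur U₀) η (τ : 𝔸 →ₗ[ℂ] ℂ) (curL (flat115 (T47 H C εC A'))) q.2.1 q.2.2 q.1 := by
  rw [V80Z, eq30a_zpow Tsh (Ucur U₀) (τ : 𝔸 →ₗ[ℂ] ℂ) hτ η (Fact.out : 0 < η).ne' 3]

variable {ρ : (𝔸 →L[ℂ] ℂ) →L[ℂ] 𝔸} {τ : 𝔸 →L[ℂ] ℂ}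

/-- ★ **THE (63) CERTIFICATE FOR `W = (δ/δA′)V` IN EVERY DIMENSION `d`**: on `‖A′‖ < a_C` (Sect. C regime, `C` of Prop.-4 type), for a tracial `τ`,
the dualising identity `τ(ρ(ℓ)X) = ℓ X` and a `Δπ` SYMMETRIC for the pairing (`⟨Δπ Y, Z⟩ = ⟨Δπ Z, Y⟩`, [5] (3.119) is a quadratic form):
`⟨W80(A′), δ⟩ = (d/dt) V80Z(A′ + tδ)|_{t=0}` — the tree's W-slot object `B11Eq80Current.W80` IS the functional derivative, in print's sense (63)/(84),
of (80) written with the integer-power remainder `V₀`; NO `4 ≤ d` (twin of `B11Eq80Current.pair27_W80`; at `4 ≤ d` the two agree by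
`V80Z_eq_V80`).  UNIQUELY by `B11Eq90Transpose.eq_of_pair27_eq`.  Proof: the three guard-free line derivatives (85), (88), (89) exactly as in
`pair27_W80`, the V₀-group by `pair27_curV0full_zpow`, and `⟨MᵗK, δ⟩ = ⟨K, Mδ⟩`.
[cite: Balaban1985Variational, (63) p.287, (84) p.290, (85)–(90) p.291] -/
theorem pair27_W80_zpow (hρ : ∀ (ℓ : 𝔸 →L[ℂ] ℂ) (X : 𝔸), τ (ρ ℓ * X) = ℓ X) (hτ : ∀ a b : 𝔸, τ (a * b) = τ (b * a))
    (U₀ : Bond d Pd → 𝔸ˣ) (RC : Regime H 0 C b 0 C₂ c₄ 0 aC εC) (hC : Prop4Hyp C C₂ c₄) [CompleteSpace 𝒳] (J : NegSize L η lev₀ 3 𝔸)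
    {Δπ : Space115 L η lev₀ lev₁ Dc →L[ℂ] NegSize L η lev₀ 3 𝔸}
    (hΔ : ∀ Y Z : Space115 L η lev₀ lev₁ Dc, pair27 τ (Δπ Y) (flat115 Z) = pair27 τ (Δπ Z) (flat115 Y))
    {A' : Space115 L η lev₀ lev₁ Dc} (hA' : ‖A'‖ < aC) (δ' : Space115 L η lev₀ lev₁ Dc) :
    pair27 τ (W80 ρ τ U₀ H C εC J Δπ A') (flat115 δ') = deriv (fun t : ℂ => V80Z τ U₀ H C εC J Δπ (A' + t • δ')) 0 := by
  have hmem : A' ∈ ball (0 : Space115 L η lev₀ lev₁ Dc) aC := mem_ball_zero_iff.2 hA'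
  have hnhds : ball (0 : Space115 L η lev₀ lev₁ Dc) aC ∈ 𝓝 A' := isOpen_ball.mem_nhds hmem
  -- differentiability of the pieces at `A′`
  have hE : DifferentiableAt ℂ (Emap H C εC) A' := ((analyticOnNhd_Emap RC hC).differentiableOn.differentiableAt hnhds)
  have hE3 : DifferentiableAt ℂ (E3 H C εC) A' := ((analyticOnNhd_E3 RC hC).differentiableOn.differentiableAt hnhds)
  -- the four line derivatives
  have h1 : HasDerivAt (fun t : ℂ => -pair27 τ J (flat115 (E3 H C εC (A' + t • δ'))))
      (-pair27 τ J (flat115 (fderiv ℂ (E3 H C εC) A' δ'))) 0 := by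
    have h := ((pairL (lev₁ := lev₁) (Dc := Dc) τ J).hasFDerivAt.comp_hasDerivAt (0 : ℂ) (hasDerivAt_comp_line hE3 δ')).neg
    simpa only [Function.comp_def, pairL_apply, Pi.neg_def] using h
  have h2 : HasDerivAt (fun t : ℂ => -pair27 τ (Δπ (Emap H C εC (A' + t • δ'))) (flat115 (A' + t • δ')))
      (-(pair27 τ (Δπ (Emap H C εC A')) (flat115 δ') + pair27 τ (Δπ (fderiv ℂ (Emap H C εC) A' δ')) (flat115 A'))) 0 := by
    have hu : HasDerivAt (fun t : ℂ => Δπ (Emap H C εC (A' + t • δ'))) (Δπ (fderiv ℂ (Emap H C εC) A' δ')) 0 :=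
      (Δπ.hasFDerivAt.comp_hasDerivAt (0 : ℂ) (hasDerivAt_comp_line hE δ'))
    have h := (ContinuousLinearMap.hasDerivAt_of_bilinear (B := pairL (lev₁ := lev₁) (Dc := Dc) τ)
      (fun _ => hu) (fun _ => hasDerivAt_line A' δ')).neg
    simpa only [pairL_apply, zero_smul, add_zero, Pi.neg_def] using h
  have h3 : HasDerivAt (fun t : ℂ => 2⁻¹ * pair27 τ (Δπ (Emap H C εC (A' + t • δ'))) (flat115 (Emap H C εC (A' + t • δ'))))
      (2⁻¹ * (pair27 τ (Δπ (Emap H C εC A')) (flat115 (fderiv ℂ (Emap H C εC) A' δ'))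
        + pair27 τ (Δπ (fderiv ℂ (Emap H C εC) A' δ')) (flat115 (Emap H C εC A')))) 0 := by
    have hu : HasDerivAt (fun t : ℂ => Δπ (Emap H C εC (A' + t • δ'))) (Δπ (fderiv ℂ (Emap H C εC) A' δ')) 0 :=
      (Δπ.hasFDerivAt.comp_hasDerivAt (0 : ℂ) (hasDerivAt_comp_line hE δ'))
    have hv : HasDerivAt (fun t : ℂ => Emap H C εC (A' + t • δ')) (fderiv ℂ (Emap H C εC) A' δ') 0 := hasDerivAt_comp_line hE δ'
    have h := (ContinuousLinearMap.hasDerivAt_of_bilinear (B := pairL (lev₁ := lev₁) (Dc := Dc) τ) (fun _ => hu) (fun _ => hv)).const_mul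
      (2⁻¹ : ℂ)
    simpa only [pairL_apply, zero_smul, add_zero] using h
  have h4 : HasDerivAt (fun t : ℂ => V0Z Tsh (Ucur U₀) η d (τ : 𝔸 →ₗ[ℂ] ℂ) (curL (flat115 (T47 H C εC (A' + t • δ')))))
      (pair27 τ (curV0full ρ τ U₀ H C εC A') (flat115 δ')) 0 := by
    have hT : DifferentiableAt ℂ (T47 H C εC) A' := (differentiableOn_T47 RC hC).differentiableAt hnhds
    have hF : Differentiable ℂ (fun Y : Space115 L η lev₀ lev₁ Dc => V0Z Tsh (Ucur U₀) η d (τ : 𝔸 →ₗ[ℂ] ℂ) (curL (flat115 Y))) :=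
      (differentiable_V0Z_torus τ hτ U₀).comp
        (((curL : (Bond d Pd → 𝔸) →L[ℂ] (Fin d → TSite d Pd → 𝔸)).comp
          (flat115 (L := L) (η := η) (lev₀ := lev₀) (lev₁ := lev₁) (Dc := Dc))).differentiable)
    have hdd := hasDerivAt_comp_line ((hF _).comp A' hT) δ'
    rw [pair27_curV0full_zpow ρ τ hρ hτ U₀ RC hC hA' (flat115 δ')]
    exact hdd.differentiableAt.hasDerivAt
  -- assemble
  have hsum := ((h1.fun_add h2).fun_add h3).fun_add h4
  have e : (fun t : ℂ => V80Z τ U₀ H C εC J Δπ (A' + t • δ'))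
      = fun t : ℂ => -pair27 τ J (flat115 (E3 H C εC (A' + t • δ')))
          + -pair27 τ (Δπ (Emap H C εC (A' + t • δ'))) (flat115 (A' + t • δ'))
          + 2⁻¹ * pair27 τ (Δπ (Emap H C εC (A' + t • δ'))) (flat115 (Emap H C εC (A' + t • δ')))
          + V0Z Tsh (Ucur U₀) η d (τ : 𝔸 →ₗ[ℂ] ℂ) (curL (flat115 (T47 H C εC (A' + t • δ')))) := by
    funext t; simp only [V80Z]; ring
  rw [e, hsum.deriv]
  -- identify the four currents: `⟨MᵗK, δ⟩ = ⟨K, Mδ⟩` and the symmetry of `Δ_π`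
  simp only [W80, W1, W2, W3, pair27_add_left, pair27_neg_left, pair27_transCur' ρ τ hρ]
  rw [hΔ (fderiv ℂ (Emap H C εC) A' δ') A', hΔ (fderiv ℂ (Emap H C εC) A' δ') (Emap H C εC A')]
  ring

/-- **COROLLARY — THE d = 4-GUARDED CERTIFICATE IS THE SPECIAL CASE**: for `4 ≤ d`, `pair27_W80_zpow` is `B11Eq80Current.pair27_W80` read through
`V80Z_eq_V80` (consistency check of the twin; nothing new). [cite: Balaban1985Variational, (63) p.287, (84) p.290] -/
theorem pair27_W80_zpow_of_le (hρ : ∀ (ℓ : 𝔸 →L[ℂ] ℂ) (X : 𝔸), τ (ρ ℓ * X) = ℓ X) (hτ : ∀ a b : 𝔸, τ (a * b) = τ (b * a)) (hd : 4 ≤ d)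
    (U₀ : Bond d Pd → 𝔸ˣ) (RC : Regime H 0 C b 0 C₂ c₄ 0 aC εC) (hC : Prop4Hyp C C₂ c₄) [CompleteSpace 𝒳] (J : NegSize L η lev₀ 3 𝔸)
    {Δπ : Space115 L η lev₀ lev₁ Dc →L[ℂ] NegSize L η lev₀ 3 𝔸}
    (hΔ : ∀ Y Z : Space115 L η lev₀ lev₁ Dc, pair27 τ (Δπ Y) (flat115 Z) = pair27 τ (Δπ Z) (flat115 Y))
    {A' : Space115 L η lev₀ lev₁ Dc} (hA' : ‖A'‖ < aC) (δ' : Space115 L η lev₀ lev₁ Dc) :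
    deriv (fun t : ℂ => V80Z τ U₀ H C εC J Δπ (A' + t • δ')) 0 = deriv (fun t : ℂ => V80 τ U₀ H C εC J Δπ (A' + t • δ')) 0 := by
  rw [← pair27_W80_zpow hρ hτ U₀ RC hC J hΔ hA' δ', pair27_W80 hρ hτ hd U₀ RC hC J hΔ hA' δ']

/-! ## §5 (v1.1, append-only) The certificate in `HasDerivAt` currency — complex and real ray parameter

The consumers of (63)/(84) on rung R3 read the ray `t ↦ V(A′ + tδ)` through their OWN `HasDerivAt` (cell `ym3-torus`, S9's inhabitability note
on `hCrit93′`: «`deriv … 0 = 0` is read by the consumer only through its own `HasDerivAt` of the ray functional»), so the `deriv`-equation of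
`pair27_W80_zpow` is re-issued as a `HasDerivAt` statement, for a complex and for a real ray parameter.  Nothing above is modified. -/

/-- **`V` OF (80) (integer-power `V₀`) IS DIFFERENTIABLE ON THE BALL `‖A′‖ < a_C`** (p. 290: «It is analytic in A′ …»): the three pairings are
continuous-bilinear images of the analytic maps `HD`, `HD₃` (`B11Eq80Current.analyticOnNhd_Emap`/`_E3`) and the fourth term is the entire `V₀`
(`differentiable_V0Z_torus`) composed with the Sect. C map (47) (`B11Eq90V0GroupComposed.differentiableOn_T47`).
[cite: Balaban1985Variational, (80) p.290, Prop. 3 p.289] -/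
theorem differentiableOn_V80Z (hτ : ∀ a b : 𝔸, τ (a * b) = τ (b * a)) (U₀ : Bond d Pd → 𝔸ˣ)
    (RC : Regime H 0 C b 0 C₂ c₄ 0 aC εC) (hC : Prop4Hyp C C₂ c₄) [CompleteSpace 𝒳] (J : NegSize L η lev₀ 3 𝔸)
    (Δπ : Space115 L η lev₀ lev₁ Dc →L[ℂ] NegSize L η lev₀ 3 𝔸) :
    DifferentiableOn ℂ (V80Z τ U₀ H C εC J Δπ) (ball (0 : Space115 L η lev₀ lev₁ Dc) aC) := by
  have hE : DifferentiableOn ℂ (Emap H C εC) (ball (0 : Space115 L η lev₀ lev₁ Dc) aC) := (analyticOnNhd_Emap RC hC).differentiableOn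
  have hE3 : DifferentiableOn ℂ (E3 H C εC) (ball (0 : Space115 L η lev₀ lev₁ Dc) aC) := (analyticOnNhd_E3 RC hC).differentiableOn
  have hT : DifferentiableOn ℂ (T47 H C εC) (ball (0 : Space115 L η lev₀ lev₁ Dc) aC) := differentiableOn_T47 RC hC
  -- the four summands
  have h1 : DifferentiableOn ℂ (fun A' : Space115 L η lev₀ lev₁ Dc => -pair27 τ J (flat115 (E3 H C εC A')))
      (ball (0 : Space115 L η lev₀ lev₁ Dc) aC) := by
    have h := ((pairL (lev₁ := lev₁) (Dc := Dc) τ J).differentiable.comp_differentiableOn hE3).neg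
    simpa only [Function.comp_def, pairL_apply, Pi.neg_def] using h
  -- the current-valued factor `A′ ↦ ⟨Δπ(HD A′), ·⟩` as a differentiable family of continuous linear functionals
  have hP : Differentiable ℂ (fun K : NegSize L η lev₀ 3 𝔸 => pairL (lev₁ := lev₁) (Dc := Dc) τ K) :=
    (pairL (lev₁ := lev₁) (Dc := Dc) τ).differentiable
  have hΔd : Differentiable ℂ (fun Y : Space115 L η lev₀ lev₁ Dc => Δπ Y) := Δπ.differentiable
  have hc : DifferentiableOn ℂ (fun A' : Space115 L η lev₀ lev₁ Dc => pairL (lev₁ := lev₁) (Dc := Dc) τ (Δπ (Emap H C εC A')))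
      (ball (0 : Space115 L η lev₀ lev₁ Dc) aC) := by
    have h := (hP.comp hΔd).comp_differentiableOn hE
    simpa only [Function.comp_def] using h
  have h2 : DifferentiableOn ℂ (fun A' : Space115 L η lev₀ lev₁ Dc => pair27 τ (Δπ (Emap H C εC A')) (flat115 A'))
      (ball (0 : Space115 L η lev₀ lev₁ Dc) aC) := by
    have h := hc.clm_apply differentiableOn_id
    simpa only [pairL_apply, id] using h
  have h3 : DifferentiableOn ℂ (fun A' : Space115 L η lev₀ lev₁ Dc => pair27 τ (Δπ (Emap H C εC A')) (flat115 (Emap H C εC A')))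
      (ball (0 : Space115 L η lev₀ lev₁ Dc) aC) := by
    have h := hc.clm_apply hE
    simpa only [pairL_apply] using h
  have h4 : DifferentiableOn ℂ (fun A' : Space115 L η lev₀ lev₁ Dc =>
      V0Z Tsh (Ucur U₀) η d (τ : 𝔸 →ₗ[ℂ] ℂ) (curL (flat115 (T47 H C εC A')))) (ball (0 : Space115 L η lev₀ lev₁ Dc) aC) := by
    have hF : Differentiable ℂ (fun Y : Space115 L η lev₀ lev₁ Dc => V0Z Tsh (Ucur U₀) η d (τ : 𝔸 →ₗ[ℂ] ℂ) (curL (flat115 Y))) :=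
      (differentiable_V0Z_torus τ hτ U₀).comp
        (((curL : (Bond d Pd → 𝔸) →L[ℂ] (Fin d → TSite d Pd → 𝔸)).comp
          (flat115 (L := L) (η := η) (lev₀ := lev₀) (lev₁ := lev₁) (Dc := Dc))).differentiable)
    exact hF.comp_differentiableOn hT
  have h := ((h1.sub h2).add (h3.const_mul (2⁻¹ : ℂ))).add h4
  refine h.congr fun A' _ => ?_
  simp only [V80Z, Pi.add_apply, Pi.sub_apply]

/-- ★ **THE (63) CERTIFICATE IN `HasDerivAt` CURRENCY, EVERY `d`**: on `‖A′‖ < a_C`, the complex ray `t ↦ V(A′ + tδ)` of (80) (integer-power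
`V₀`) HAS DERIVATIVE `⟨W(A′), δ⟩` at `t = 0` — the form in which a consumer's own `HasDerivAt` of a ray functional composes with (84)
(`pair27_W80_zpow` + `differentiableOn_V80Z`). [cite: Balaban1985Variational, (63) p.287, (84) p.290] -/
theorem hasDerivAt_V80Z_line (hρ : ∀ (ℓ : 𝔸 →L[ℂ] ℂ) (X : 𝔸), τ (ρ ℓ * X) = ℓ X) (hτ : ∀ a b : 𝔸, τ (a * b) = τ (b * a))
    (U₀ : Bond d Pd → 𝔸ˣ) (RC : Regime H 0 C b 0 C₂ c₄ 0 aC εC) (hC : Prop4Hyp C C₂ c₄) [CompleteSpace 𝒳] (J : NegSize L η lev₀ 3 𝔸)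
    {Δπ : Space115 L η lev₀ lev₁ Dc →L[ℂ] NegSize L η lev₀ 3 𝔸}
    (hΔ : ∀ Y Z : Space115 L η lev₀ lev₁ Dc, pair27 τ (Δπ Y) (flat115 Z) = pair27 τ (Δπ Z) (flat115 Y))
    {A' : Space115 L η lev₀ lev₁ Dc} (hA' : ‖A'‖ < aC) (δ' : Space115 L η lev₀ lev₁ Dc) :
    HasDerivAt (fun t : ℂ => V80Z τ U₀ H C εC J Δπ (A' + t • δ')) (pair27 τ (W80 ρ τ U₀ H C εC J Δπ A') (flat115 δ')) 0 := by
  have hV : DifferentiableAt ℂ (V80Z τ U₀ H C εC J Δπ) A' :=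
    (differentiableOn_V80Z hτ U₀ RC hC J Δπ).differentiableAt (isOpen_ball.mem_nhds (mem_ball_zero_iff.2 hA'))
  have h := hasDerivAt_comp_line hV δ'
  rw [pair27_W80_zpow hρ hτ U₀ RC hC J hΔ hA' δ']
  exact h.differentiableAt.hasDerivAt

/-- **THE SAME ALONG A REAL RAY PARAMETER** (`t : ℝ`, as the variational problem is posed for real `δA′`): `t ↦ V(A′ + tδ)` has derivative
`⟨W(A′), δ⟩` at `0` (`HasDerivAt.comp_ofReal` on `hasDerivAt_V80Z_line`). [cite: Balaban1985Variational, (63) p.287, (82)–(84) p.290] -/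
theorem hasDerivAt_V80Z_line_real (hρ : ∀ (ℓ : 𝔸 →L[ℂ] ℂ) (X : 𝔸), τ (ρ ℓ * X) = ℓ X) (hτ : ∀ a b : 𝔸, τ (a * b) = τ (b * a))
    (U₀ : Bond d Pd → 𝔸ˣ) (RC : Regime H 0 C b 0 C₂ c₄ 0 aC εC) (hC : Prop4Hyp C C₂ c₄) [CompleteSpace 𝒳] (J : NegSize L η lev₀ 3 𝔸)
    {Δπ : Space115 L η lev₀ lev₁ Dc →L[ℂ] NegSize L η lev₀ 3 𝔸}
    (hΔ : ∀ Y Z : Space115 L η lev₀ lev₁ Dc, pair27 τ (Δπ Y) (flat115 Z) = pair27 τ (Δπ Z) (flat115 Y))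
    {A' : Space115 L η lev₀ lev₁ Dc} (hA' : ‖A'‖ < aC) (δ' : Space115 L η lev₀ lev₁ Dc) :
    HasDerivAt (fun t : ℝ => V80Z τ U₀ H C εC J Δπ (A' + (t : ℂ) • δ')) (pair27 τ (W80 ρ τ U₀ H C εC J Δπ A') (flat115 δ')) 0 := by
  have h := hasDerivAt_V80Z_line hρ hτ U₀ RC hC J hΔ hA' δ'
  rw [← Complex.ofReal_zero] at h
  exact h.comp_ofReal

end Current

end Literature.MathematicalPhysics.QuantumFieldTheory.Balaban1983to89.B11Eq80CurrentZpow

end
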